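import Literature.NumberTheory.DiophantineGeometry.GenEllPhiMechanism
import HarnessLib

/-!
# [GenEll] Thm. 2.1 (ii) ⇒ (i) for `ℙ¹`: the mechanism bookkeeping with an arbitrary finite support

S. Mochizuki, *Arithmetic elliptic curves in general position*, Math. J. Okayama Univ. 52 (2010)
[cite: MochizukiGenEll2010, Thm 2.1 p.12], proof of Thm. 2.1, p. 12: "Let `V ⊆ V(ℚ)` be a finite subset
that contains `V(ℚ)^arc` and [the subset of `V(ℚ)^non` determined by] `Σ`" — the compactly bounded subset
produced in the proof may have support LARGER than `Σ`; statement (ii) ("whose support contains `Σ`")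
allows this.

The tree's `vojtaIneq_of_belyi_mechanism` (`GenEllPhiMechanism`, p414036) was stated with the auxiliary
points `ρ'`-far from the cusps at `∞` and at `2` only. The W5 coordinator's interface contract for the
bad primes (abc-iut cell, w5-d045, ruling R-a′: separation hypotheses at every prime of a finite set
`S_bad(e, B) ∋ 2`) needs the same bookkeeping with an arbitrary finite set of primes `S ⊇ Σ`. This file
supplies it:

* `vojtaIneq_farFromCusps_of_subset` — statement (ii) for `Σ` gives Vojta on the points `ρ`-far from the
  cusps at `∞` and at every prime of any finite `S ⊇ Σ` (the annulus with support `{∞} ∪ S`);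
* `vojtaIneq_of_belyi_mechanism_of_subset` — `vojtaIneq_of_belyi_mechanism` with `hZfar` at such an `S`.

Theorems only; no definitions, no named facts.
-/

noncomputable section

open NumberField

namespace Literature.NumberTheory.DiophantineGeometry.GenEll

/-- **Statement (ii) for `Σ` applies to the annulus with any larger finite prime support `S ⊇ Σ`**:
Vojta in degree `≤ d` on the points `ρ`-far from the cusps at `∞` and at the primes of `S`.
[cite: MochizukiGenEll2010, Thm 2.1 p.12] -/
theorem vojtaIneq_farFromCusps_of_subset {S₀ S : Finset ℕ} (hS : ∀ p ∈ S, p.Prime) (hsub : S₀ ⊆ S)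
    (h : ABCCompactlyBounded S₀) {d : ℕ} (hd : 0 < d) {ε : ℝ} (hε : 0 < ε) {ρ : ℝ} (h0 : 0 < ρ)
    (h2 : ρ ≤ 1 / 2) : VojtaIneq {P : NFPoint | P.FarFromCusps S ρ} d ε :=
  (h d hd ε hε (CBData.annulus S hS ρ h0 h2)
      (hsub.trans (CBData.annulus_supportContains S hS ρ h0 h2))).mono
    (Set.inter_subset_inter_left _ (setOf_farFromCusps_subset_toSet hS h0 h2))

/-- **The noncritical-Belyi mechanism, bookkeeping form, with separation at a finite set of primes
`S ⊇ Σ`** (same statement and proof as `vojtaIneq_of_belyi_mechanism`, the auxiliary points `Z P` being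
`ρ'`-far from the cusps at `∞` and at every `p ∈ S`; statement (ii) is assumed for `Σ = S₀ ⊆ S`).
[cite: MochizukiGenEll2010, Thm 2.1 p.13] -/
theorem vojtaIneq_of_belyi_mechanism_of_subset {S₀ S : Finset ℕ} (hS : ∀ p ∈ S, p.Prime)
    (hsub : S₀ ⊆ S) (hii : ABCCompactlyBounded S₀)
    {T : Set NFPoint} {d d' : ℕ} (hd' : 0 < d') {ε ε' ρ' : ℝ} (hε' : 0 < ε')
    (hρ'0 : 0 < ρ') (hρ'2 : ρ' ≤ 1 / 2)
    (Z Q : NFPoint → NFPoint) (κ : NFPoint → ℝ) {A Bc c₁ c₂ c₃ : ℝ}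
    (hZmem : ∀ P ∈ T ∩ UPle d, Z P ∈ UPle d')
    (hZfar : ∀ P ∈ T ∩ UPle d, (Z P).FarFromCusps S ρ')
    (hZht : ∀ P ∈ T ∩ UPle d, A * P.ht ≤ (Z P).ht + c₁)
    (hZcond : ∀ P ∈ T ∩ UPle d, (Z P).logDiff + (Z P).logCond ≤ (Q P).logDiff + κ P)
    (hκ : ∀ P ∈ T ∩ UPle d, κ P ≤ Bc * P.ht + c₂)
    (hQ : ∀ P ∈ T ∩ UPle d, (Q P).logDiff ≤ P.logDiff + P.logCond + c₃)
    (hslope : 0 < A - (1 + ε') * Bc) (hε : (1 + ε') / (A - (1 + ε') * Bc) ≤ 1 + ε) :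
    VojtaIneq T d ε := by
  obtain ⟨C, hC⟩ := vojtaIneq_farFromCusps_of_subset hS hsub hii hd' hε' hρ'0 hρ'2
  have key : BDLe (T ∩ UPle d) (fun P => (1 - (1 - (A - (1 + ε') * Bc))) * P.ht)
      (fun P => (1 + ε') * (P.logDiff + P.logCond)) := by
    refine ⟨C + c₁ + (1 + ε') * (c₂ + c₃), fun P hP => ?_⟩
    have hZ : Z P ∈ {P : NFPoint | P.FarFromCusps S ρ'} ∩ UPle d' := ⟨hZfar P hP, hZmem P hP⟩
    have h1 : (Z P).ht - (1 + ε') * ((Z P).logDiff + (Z P).logCond) ≤ C := hC _ hZ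
    have h2' := hZht P hP
    have h3 := hZcond P hP
    have h4 := hκ P hP
    have h5 := hQ P hP
    have hε'1 : 0 ≤ 1 + ε' := by linarith
    have h6 : (1 + ε') * ((Z P).logDiff + (Z P).logCond) ≤
        (1 + ε') * (P.logDiff + P.logCond + c₃ + Bc * P.ht + c₂) := by
      refine mul_le_mul_of_nonneg_left ?_ hε'1
      linarith
    simp only
    nlinarith
  exact vojtaIneq_of_scaled (δ := 1 - (A - (1 + ε') * Bc)) (by linarith) (by simpa using hε) key

end Literature.NumberTheory.DiophantineGeometry.GenEll

end
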